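import Literature.Barriers.Schanuel.NesterenkoModularScopeMeasureOfCore
import Literature.Barriers.Schanuel.NesterenkoModularScopeSeriesHolds
import Literature.NumberTheory.Transcendental.NesterenkoEliminationProp411Holds
import HarnessLib

/-!
# Discharged fact: Nesterenko's measure of algebraic independence for `q, P(q), Q(q), R(q)`
# (Nesterenko–Philippon (eds.), LNM 1752, Ch. 3, Theorem 5.1) holds

`Literature.Barriers.Schanuel.NesterenkoPhilippon2001_ch3_thm_5_1`
(`Barriers/Schanuel/NesterenkoModularScopeMeasure`: the quantitative form of Nesterenko's theorem
on the Ramanujan functions — a measure of algebraic independence of any three of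
`q, P(q), Q(q), R(q)`, LNM 1752 Ch. 3 Thm. 5.1 = Nesterenko, Proc. Steklov Inst. 218 (1997)) was
reduced in the tree, along its printed proof, to Prop. 4.11 (the metric Bézout inequality) and
Lemma 2.2 (the auxiliary-function lemma) by
`NesterenkoPhilippon2001_ch3_thm_5_1_of_prop_4_11_of_lemma_2_2`
(`Barriers/Schanuel/NesterenkoModularScopeMeasureOfCore`, with Prop. 4.4, 4.7, Cor. 4.9, 4.12,
Prop. 4.13 already discharged there).  Both remaining inputs are theorems of the tree —
`NesterenkoPhilippon2001_ch3_prop_4_11_holds` (`NumberTheory/Transcendental/NesterenkoEliminationProp411Holds`)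
and `NesterenkoPhilippon2001_ch3_lemma_2_2_holds` (`Barriers/Schanuel/NesterenkoModularScopeSeriesHolds`)
— so the fact is discharged by the one-line application below (announced in the docstring of
`…MeasureOfCore` as "the discharge `NesterenkoPhilippon2001_ch3_thm_5_1_holds` is the first of these
applied to …").  No statement is changed; no definition, no new named fact (D-0026); this is a
THEOREM file inside `Literature/Barriers/` (the barrier fact itself is untouched); net Literature
debt **−1**.

## References

* Yu. V. Nesterenko, P. Philippon (eds.), *Introduction to Algebraic Independence Theory*, LNM 1752
  (2001), Ch. 3, Theorem 5.1 and its proof (pp. 41–46), Prop. 4.11 (pp. 40–41), Lemma 2.2 (p. 31).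
  [NesterenkoPhilippon2001]
* Yu. V. Nesterenko, *On the measure of algebraic independence of the values of Ramanujan
  functions*, Proc. Steklov Inst. Math. 218 (1997) 294–331 (the original of Theorem 5.1).
-/

noncomputable section

namespace Literature.Barriers.Schanuel

/-- **LNM 1752 Ch. 3 Theorem 5.1 (Nesterenko's measure of algebraic independence of the Ramanujan
functions) — the named fact `NesterenkoPhilippon2001_ch3_thm_5_1` holds**
(`NesterenkoPhilippon2001_ch3_thm_5_1_of_prop_4_11_of_lemma_2_2` applied to
`NesterenkoPhilippon2001_ch3_prop_4_11_holds` and `NesterenkoPhilippon2001_ch3_lemma_2_2_holds`).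
[cite: NesterenkoPhilippon2001, Ch. 3 Theorem 5.1 and its proof (pp. 41–46)] -/
theorem NesterenkoPhilippon2001_ch3_thm_5_1_holds : NesterenkoPhilippon2001_ch3_thm_5_1 :=
  NesterenkoPhilippon2001_ch3_thm_5_1_of_prop_4_11_of_lemma_2_2
    Literature.NumberTheory.Transcendental.Nesterenko.NesterenkoPhilippon2001_ch3_prop_4_11_holds
    NesterenkoPhilippon2001_ch3_lemma_2_2_holds

end Literature.Barriers.Schanuel

end
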